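import Summits.ResolutionOfSingularities.ResolutionOfSingularities.Theorems.HomologicalConductorNoZenoBaseIdealCartier
import Literature.AlgebraicGeometry.Resolution.StalkIdealLemmas
import Literature.AlgebraicGeometry.Resolution.AffineBlowupUniversal
import HarnessLib

/-!
# Crux `NoZenoR` (stmt-ResolutionOfSingularities-19943), slot `stub_L1wCoreF3`, (B1) split core, UP-2 input BY NAME:
# the sandwich clause lifts the resolution to the blow-up of the base ideal

Route `ResolutionOfSingularities/HomologicalConductor`.  OURS (cell res-hironaka, crux chain W4.4, lead seat
res-L0-w44-lead-1 g8, memo `B1-CENSUS-g8.md` §1 UP-2); nothing here is a statement of the manuscript under review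
(Hironaka 2017); AI-written, weaker than expert review.

UP-2 of the (B1) split core is the tree's chart-resolution theorem
`SurfaceTermination.ChartResolution.exists_isResolution_chartMorphism`, whose input is a morphism
`σ_B : X¹ → Bl_𝔞(Spec S) = affineBlowup 𝔞` over `Spec S`.  By the universal property (`Blowups.IsBlowup.lift` with
`affineBlowup.isBlowup`) such a `σ_B` exists as soon as the inverse image ideal sheaf
`(affineBlowup.idealSheaf 𝔞).comap π` is an effective Cartier divisor.  This file identifies that inverse image with
the base ideal sheaf `𝔞𝒪_X = ofIdealTop (𝔞·Γ(X, 𝒪_X))` of `…NoZenoExcOrderStalks` / `…NoZenoBaseIdealCartier` (same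
stalks `𝔞·𝒪_(X,x)` everywhere, tree `stalkIdeal_comap_eq_map_stalkMap` + `le_of_forall_stalkIdeal_le`) and concludes:

* `stalkIdeal_comap_affineBlowupIdealSheaf` — `((affineBlowup.idealSheaf 𝔞).comap π)_x = 𝔞·𝒪_(X,x)`;
* `comap_affineBlowupIdealSheaf_eq_baseIdeal` — `(affineBlowup.idealSheaf 𝔞).comap π = 𝔞𝒪_X`;
* `isEffectiveCartier_comap_affineBlowupIdealSheaf` — under the sandwich clause (`𝔞 ≠ 0`, `𝔪ᶜ ≤ 𝔞`,
  `𝔞·𝒪_(X,x)` principal wherever `T → 𝒪_(X,x)` is local) the inverse image is an effective Cartier divisor;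
* `exists_lift_affineBlowup` — **hence `π` lifts: `∃ σ_B : X ⟶ affineBlowup 𝔞, σ_B ≫ affineBlowup.π 𝔞 = π`** —
  the `σB`/`hσB` binders of `exists_isResolution_chartMorphism`.

References: U. Görtz, T. Wedhorn, *Algebraic Geometry I* (2020), Def. 13.90 / Prop. 13.91 [`GortzWedhorn2020`]; The
Stacks Project, Tag 0806 [`StacksProject`].
-/

noncomputable section

-- single-problem summit: the doubled namespace component `ResolutionOfSingularities` is forced
set_option linter.dupNamespace false

namespace Summit.ResolutionOfSingularities.ResolutionOfSingularities.Theorems.NoZeno.ExcCount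

open CategoryTheory AlgebraicGeometry TopologicalSpace IsLocalRing Opposite
open Literature.AlgebraicGeometry Literature.AlgebraicGeometry.Resolution Literature.AlgebraicGeometry.Motives

variable {T : Type} [CommRing T] {X : Scheme.{0}} (π : X ⟶ Spec (.of T)) (𝔞 : Ideal T)

/-- The stalk of the ideal sheaf of `𝔞` on `Spec T` at `y` is generated by the germs of the global sections
`𝔞 ⊆ T = Γ(Spec T, 𝒪)`. [folklore] -/
theorem stalkIdeal_affineBlowupIdealSheaf (y : Spec (.of T)) :
    stalkIdeal (affineBlowup.idealSheaf 𝔞) y =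
      𝔞.map (((Spec (.of T)).presheaf.germ ⊤ y trivial).hom.comp (Scheme.ΓSpecIso (.of T)).inv.hom) := by
  rw [affineBlowup.idealSheaf,
    stalkIdeal_eq_map_germ _ ⟨⊤, isAffineOpen_top _⟩ (Set.mem_univ y),
    Scheme.IdealSheafData.ofIdealTop_ideal, Ideal.map_map, Ideal.map_map]
  congr 1

/-- **`((affineBlowup.idealSheaf 𝔞).comap π)_x = 𝔞·𝒪_(X,x)`** (in the `ExcCount.toStalk` spelling). [folklore] -/
theorem stalkIdeal_comap_affineBlowupIdealSheaf (x : X) :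
    stalkIdeal ((affineBlowup.idealSheaf 𝔞).comap π) x = 𝔞.map (toStalk π x) := by
  rw [stalkIdeal_comap_eq_map_stalkMap, stalkIdeal_affineBlowupIdealSheaf, Ideal.map_map]
  congr 1
  apply RingHom.ext
  intro t
  rw [toStalk_eq_germ_comp_algebraMapΓ]
  simp only [RingHom.coe_comp, Function.comp_apply]
  exact Scheme.Hom.germ_stalkMap_apply π ⊤ x trivial ((Scheme.ΓSpecIso (.of T)).inv.hom t)

/-- **`(affineBlowup.idealSheaf 𝔞).comap π = 𝔞𝒪_X`**: both ideal sheaves have the stalk `𝔞·𝒪_(X,x)` at every point.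
[folklore] -/
theorem comap_affineBlowupIdealSheaf_eq_baseIdeal :
    (affineBlowup.idealSheaf 𝔞).comap π = Scheme.IdealSheafData.ofIdealTop (𝔞.map (Morphisms.algebraMapΓ π)) := by
  apply le_antisymm <;> refine le_of_forall_stalkIdeal_le fun x => ?_ <;>
    rw [stalkIdeal_comap_affineBlowupIdealSheaf, stalkIdeal_baseIdeal_eq_map_toStalk]

/-- **The inverse image of the base ideal is an effective Cartier divisor** under the sandwich clause: `T` local,
`𝔞 ≠ 0`, `𝔪ᶜ ≤ 𝔞`, `𝔞·𝒪_(X,x)` principal wherever `T → 𝒪_(X,x)` is local (`…NoZenoBaseIdealCartier`).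
[cite: StacksProject, Tag 01WS] -/
theorem isEffectiveCartier_comap_affineBlowupIdealSheaf [IsLocalRing T] [IsDomain T] [IsIntegral X]
    [IsLocallyNoetherian X] [IsDominant π] [QuasiCompact π] (h𝔞0 : 𝔞 ≠ ⊥) {c : ℕ} (hc : maximalIdeal T ^ c ≤ 𝔞)
    (hprin : ∀ x : X, IsLocalHom (toStalk π x) → (𝔞.map (toStalk π x)).IsPrincipal) :
    IsEffectiveCartier ((affineBlowup.idealSheaf 𝔞).comap π) := by
  rw [comap_affineBlowupIdealSheaf_eq_baseIdeal]
  exact isEffectiveCartier_baseIdeal π h𝔞0 hc hprin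

/-- **UP-2 input BY NAME: `π` lifts to the blow-up of `𝔞`.**  Under the sandwich clause there is
`σ_B : X ⟶ affineBlowup 𝔞` with `σ_B ≫ affineBlowup.π 𝔞 = π` (universal property of the blow-up, tree
`affineBlowup.isBlowup` + `IsBlowup.lift`) — the `σB`/`hσB` binders of
`SurfaceTermination.ChartResolution.exists_isResolution_chartMorphism`. [cite: GortzWedhorn2020, Def. 13.90 (p. 413)] -/
theorem exists_lift_affineBlowup [IsLocalRing T] [IsDomain T] [IsIntegral X] [IsLocallyNoetherian X]
    [IsDominant π] [QuasiCompact π] (h𝔞0 : 𝔞 ≠ ⊥) {c : ℕ} (hc : maximalIdeal T ^ c ≤ 𝔞)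
    (hprin : ∀ x : X, IsLocalHom (toStalk π x) → (𝔞.map (toStalk π x)).IsPrincipal) :
    ∃ σB : X ⟶ affineBlowup 𝔞, σB ≫ affineBlowup.π 𝔞 = π :=
  ⟨(affineBlowup.isBlowup 𝔞).lift π (isEffectiveCartier_comap_affineBlowupIdealSheaf π 𝔞 h𝔞0 hc hprin),
    (affineBlowup.isBlowup 𝔞).lift_comp π _⟩

end Summit.ResolutionOfSingularities.ResolutionOfSingularities.Theorems.NoZeno.ExcCount

end
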